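import Mathlib
import Summits.MatrixMultiplication.MatrixMultiplication.Theorems.FidelityWitnessesRankTwoAdditivityKeyLemma

/-!
# `FidelityWitnesses.RankTwoAdditivity` (stmt-MatrixMultiplication-4964) — key lemma (general)

The key lemma `key_lemma` for arbitrary `φ : Fin 2 → κ → ℂ` on the slice `Re ∑ π_ij ⟨φ_i,φ_j⟩ = ‖φ‖²`:
`F(φ) ≤ ‖φ‖²`, reduced to `key_lemma_orth` by rotating the second tensor factor with the unitary that
diagonalises the 2×2 Gram matrix of `φ` (`Matrix.IsHermitian.eigenvectorUnitary`).
Supports item `stmt-MatrixMultiplication-4964`; no definitions are introduced.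
-/

namespace Summit.MatrixMultiplication.MatrixMultiplication.Theorems.RankTwoAdditivity

open scoped BigOperators ComplexConjugate ComplexOrder Matrix

/-- `∑_j δ_{ij} f j = f i` on `Fin 2`. -/
theorem sum_delta_fin_two (f : Fin 2 → ℂ) (i : Fin 2) :
    (∑ j, (if i = j then (1 : ℂ) else 0) * f j) = f i := by
  fin_cases i <;> simp

/-- `∑_j f j δ_{ji}  = f i` on `Fin 2`. -/
theorem sum_delta_fin_two' (f : Fin 2 → ℂ) (i : Fin 2) :
    (∑ j, f j * (if j = i then (1 : ℂ) else 0)) = f i := by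
  fin_cases i <;> simp

/-- **Key lemma.** For HS-orthonormal `Q 0, Q 1 : κ × μ → ℂ`, an orthonormal pair `w 0, w 1 ∈ ℂ^{2×2}` and any
`φ : Fin 2 → κ → ℂ` on the slice `Re ∑_{ij} π_ij ⟨φ_i, φ_j⟩ = ‖φ‖²`:
`∑_r ∑_c |∑_{(k,i)} conj(w r (k,i)) (Q_k* φ_i)(c)|² ≤ ‖φ‖²`.
(Reduction to orthogonal components by the unitary diagonalising the Gram matrix of `φ`.) -/
theorem key_lemma {κ μ : Type*} [Fintype κ] [Fintype μ]
    (Q : Fin 2 → κ × μ → ℂ) (hQ : ∀ k l, (∑ c, conj (Q k c) * Q l c) = if k = l then 1 else 0)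
    (w : Fin 2 → Fin 2 × Fin 2 → ℂ) (hw : ∀ r s, (∑ a, conj (w r a) * w s a) = if r = s then 1 else 0)
    (φ : Fin 2 → κ → ℂ)
    (hslice : (∑ i, ∑ j, (∑ r, ∑ k, w r (k, i) * conj (w r (k, j))) * ∑ m, conj (φ i m) * φ j m).re
      = ∑ i, ∑ m, ‖φ i m‖ ^ 2) :
    (∑ r, ∑ c, ‖∑ a : Fin 2 × Fin 2, conj (w r a) * ∑ m, conj (Q a.1 (m, c)) * φ a.2 m‖ ^ 2)
      ≤ ∑ i, ∑ m, ‖φ i m‖ ^ 2 := by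
  classical
  -- Gram matrix of φ and its diagonalising unitary
  set G : Matrix (Fin 2) (Fin 2) ℂ := Matrix.of fun i j => ∑ m, conj (φ i m) * φ j m with hG
  have hGh : G.IsHermitian := by
    apply Matrix.IsHermitian.ext
    intro i j
    simp only [hG, Matrix.of_apply, Complex.star_def, map_sum, map_mul, Complex.conj_conj]
    exact Finset.sum_congr rfl fun m _ => mul_comm _ _
  set U : Matrix (Fin 2) (Fin 2) ℂ := (hGh.eigenvectorUnitary : Matrix (Fin 2) (Fin 2) ℂ) with hU
  have hU1 : Uᴴ * U = 1 := by
    have := Unitary.coe_star_mul_self hGh.eigenvectorUnitary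
    simpa [Matrix.star_eq_conjTranspose] using this
  have hU2 : U * Uᴴ = 1 := by
    have := Unitary.coe_mul_star_self hGh.eigenvectorUnitary
    simpa [Matrix.star_eq_conjTranspose] using this
  have hdiagz : (Uᴴ * G * U) 0 1 = 0 := by
    have h3 : Uᴴ * G * U = Matrix.diagonal (RCLike.ofReal ∘ hGh.eigenvalues) := by
      have := hGh.conjStarAlgAut_star_eigenvectorUnitary
      rw [Unitary.conjStarAlgAut_star_apply] at this
      simpa [Matrix.star_eq_conjTranspose] using this
    rw [h3, Matrix.diagonal_apply_ne]
    decide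
  have hδ1 : ∀ i j, (∑ a, conj (U a i) * U a j) = if i = j then 1 else 0 := by
    intro i j
    have := congrFun (congrFun hU1 i) j
    simpa [Matrix.mul_apply, Matrix.conjTranspose_apply, Matrix.one_apply] using this
  have hδ2 : ∀ i j, (∑ a, U i a * conj (U j a)) = if i = j then 1 else 0 := by
    intro i j
    have := congrFun (congrFun hU2 i) j
    simpa [Matrix.mul_apply, Matrix.conjTranspose_apply, Matrix.one_apply] using this
  -- rotated data
  set φ' : Fin 2 → κ → ℂ := fun a m => ∑ i, U i a * φ i m with hφ'
  set w' : Fin 2 → Fin 2 × Fin 2 → ℂ := fun r p => ∑ i, w r (p.1, i) * U i p.2 with hw'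
  -- (R1) orthogonality of the rotated components
  have e1 : ∀ a b, (∑ m, conj (φ' a m) * φ' b m) = ∑ i, ∑ j, conj (U i a) * U j b * G i j := by
    intro a b
    have hm : ∀ m, conj (φ' a m) * φ' b m = ∑ i, ∑ j, conj (U i a) * U j b * (conj (φ i m) * φ j m) := by
      intro m
      simp only [hφ', map_sum, map_mul, Finset.sum_mul, Finset.mul_sum]
      rw [Finset.sum_comm]
      exact Finset.sum_congr rfl fun i _ => Finset.sum_congr rfl fun j _ => by ring
    rw [Finset.sum_congr rfl fun m _ => hm m, Finset.sum_comm]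
    refine Finset.sum_congr rfl fun i _ => ?_
    rw [Finset.sum_comm]
    refine Finset.sum_congr rfl fun j _ => ?_
    rw [hG, Matrix.of_apply, Finset.mul_sum]
  have e2 : ∀ a b, (Uᴴ * G * U) a b = ∑ i, ∑ j, conj (U i a) * U j b * G i j := by
    intro a b
    simp only [Matrix.mul_apply, Matrix.conjTranspose_apply, Complex.star_def, Finset.sum_mul]
    rw [Finset.sum_comm]
    exact Finset.sum_congr rfl fun i _ => Finset.sum_congr rfl fun j _ => by ring
  have horth' : (∑ m, conj (φ' 0 m) * φ' 1 m) = 0 := by rw [e1, ← e2, hdiagz]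
  have hδ3 : ∀ i j, (∑ a, conj (U i a) * U j a) = if i = j then 1 else 0 := by
    intro i j
    have := hδ2 j i
    rw [show (∑ a, U j a * conj (U i a)) = ∑ a, conj (U i a) * U j a from
      Finset.sum_congr rfl fun a _ => mul_comm _ _] at this
    rw [this]
    by_cases h : i = j
    · subst h; simp
    · simp [h, Ne.symm h]
  -- (R2) orthonormality of the rotated projector vectors
  have hw'on : ∀ r s, (∑ p, conj (w' r p) * w' s p) = if r = s then 1 else 0 := by
    intro r s
    rw [← hw r s, Fintype.sum_prod_type, Fintype.sum_prod_type]
    refine Finset.sum_congr rfl fun k _ => ?_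
    -- ∑ a conj(∑ i w r (k,i) U i a) (∑ j w s (k,j) U j a) = ∑ i conj(w r (k,i)) w s (k,i)
    have L : (∑ a, conj (w' r (k, a)) * w' s (k, a))
        = ∑ i, ∑ j, conj (w r (k, i)) * w s (k, j) * ∑ a, conj (U i a) * U j a := by
      have : ∀ a, conj (w' r (k, a)) * w' s (k, a)
          = ∑ i, ∑ j, conj (w r (k, i)) * w s (k, j) * (conj (U i a) * U j a) := by
        intro a
        simp only [hw', map_sum, map_mul, Finset.sum_mul, Finset.mul_sum]
        rw [Finset.sum_comm]
        exact Finset.sum_congr rfl fun i _ => Finset.sum_congr rfl fun j _ => by ring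
      rw [Finset.sum_congr rfl fun a _ => this a, Finset.sum_comm]
      refine Finset.sum_congr rfl fun i _ => ?_
      rw [Finset.sum_comm]
      refine Finset.sum_congr rfl fun j _ => ?_
      rw [Finset.mul_sum]
    rw [L]
    simp only [hδ3, mul_ite, mul_one, mul_zero]
    exact Finset.sum_congr rfl fun i _ => by rw [Finset.sum_ite_eq]; simp
  -- (R4) the value of F is unchanged
  have hF : ∀ r c, (∑ p : Fin 2 × Fin 2, conj (w' r p) * ∑ m, conj (Q p.1 (m, c)) * φ' p.2 m)
      = ∑ p : Fin 2 × Fin 2, conj (w r p) * ∑ m, conj (Q p.1 (m, c)) * φ p.2 m := by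
    intro r c
    rw [Fintype.sum_prod_type, Fintype.sum_prod_type]
    refine Finset.sum_congr rfl fun k _ => ?_
    set g : Fin 2 → ℂ := fun i => ∑ m, conj (Q k (m, c)) * φ i m with hg
    have hg' : ∀ a, (∑ m, conj (Q k (m, c)) * φ' a m) = ∑ j, U j a * g j := by
      intro a
      simp only [hφ', hg, Finset.mul_sum]
      rw [Finset.sum_comm]
      exact Finset.sum_congr rfl fun j _ => Finset.sum_congr rfl fun m _ => by ring
    change (∑ a, conj (w' r (k, a)) * ∑ m, conj (Q k (m, c)) * φ' a m) = ∑ i, conj (w r (k, i)) * g i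
    simp only [hg']
    clear_value g
    have L : (∑ a, conj (w' r (k, a)) * ∑ j, U j a * g j)
        = ∑ i, ∑ j, conj (w r (k, i)) * g j * ∑ a, conj (U i a) * U j a := by
      have : ∀ a, conj (w' r (k, a)) * (∑ j, U j a * g j)
          = ∑ i, ∑ j, conj (w r (k, i)) * g j * (conj (U i a) * U j a) := by
        intro a
        simp only [hw', map_sum, map_mul, Finset.sum_mul, Finset.mul_sum]
        rw [Finset.sum_comm]
        exact Finset.sum_congr rfl fun i _ => Finset.sum_congr rfl fun j _ => by ring
      rw [Finset.sum_congr rfl fun a _ => this a, Finset.sum_comm]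
      refine Finset.sum_congr rfl fun i _ => ?_
      rw [Finset.sum_comm]
      refine Finset.sum_congr rfl fun j _ => ?_
      rw [Finset.mul_sum]
    rw [L]
    simp only [hδ3, mul_ite, mul_one, mul_zero]
    exact Finset.sum_congr rfl fun i _ => by rw [Finset.sum_ite_eq]; simp
  -- (R3) the slice condition is unchanged (matrix bookkeeping)
  set P : Matrix (Fin 2) (Fin 2) ℂ := Matrix.of fun i j => ∑ r, ∑ k, w r (k, i) * conj (w r (k, j)) with hP
  have hUbar : U.map conj * Uᵀ = 1 := by
    have h := congrArg (fun M : Matrix (Fin 2) (Fin 2) ℂ => M.map conj) hU2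
    simp only [Matrix.map_mul] at h
    have e : Uᴴ.map conj = Uᵀ := by
      ext i j; simp [Matrix.conjTranspose_apply, Matrix.map_apply]
    rw [e] at h
    rw [h]
    ext i j
    simp [Matrix.one_apply, Matrix.map_apply]
  have hπ' : ∀ a b, (∑ r, ∑ k, w' r (k, a) * conj (w' r (k, b))) = (Uᵀ * P * U.map conj) a b := by
    intro a b
    -- RHS = ∑ i ∑ j U i a P i j conj(U j b)
    have R : (Uᵀ * P * U.map conj) a b = ∑ i, ∑ j, U i a * conj (U j b) * P i j := by
      simp only [Matrix.mul_apply, Matrix.transpose_apply, Matrix.map_apply, Finset.sum_mul]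
      rw [Finset.sum_comm]
      exact Finset.sum_congr rfl fun i _ => Finset.sum_congr rfl fun j _ => by ring
    rw [R]
    simp only [hP, Matrix.of_apply, Finset.mul_sum]
    -- LHS: ∑ r ∑ k (∑ i w U)(∑ j conj w conj U) ; RHS: ∑ i ∑ j ∑ r ∑ k U i a conj(U j b) (w r (k,i) conj(w r (k,j)))
    have L : (∑ r, ∑ k, w' r (k, a) * conj (w' r (k, b)))
        = ∑ r, ∑ k, ∑ i, ∑ j, U i a * conj (U j b) * (w r (k, i) * conj (w r (k, j))) := by
      refine Finset.sum_congr rfl fun r _ => Finset.sum_congr rfl fun k _ => ?_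
      simp only [hw', map_sum, map_mul, Finset.sum_mul, Finset.mul_sum]
      rw [Finset.sum_comm]
      exact Finset.sum_congr rfl fun i _ => Finset.sum_congr rfl fun j _ => by ring
    rw [L]
    -- reorder ∑ r ∑ k ∑ i ∑ j  →  ∑ i ∑ j ∑ r ∑ k
    have s1 : ∀ r, (∑ k, ∑ i, ∑ j, U i a * conj (U j b) * (w r (k, i) * conj (w r (k, j))))
        = ∑ i, ∑ j, ∑ k, U i a * conj (U j b) * (w r (k, i) * conj (w r (k, j))) := by
      intro r; rw [Finset.sum_comm]; exact Finset.sum_congr rfl fun i _ => Finset.sum_comm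
    rw [Finset.sum_congr rfl fun r _ => s1 r, Finset.sum_comm]
    refine Finset.sum_congr rfl fun i _ => ?_
    rw [Finset.sum_comm]
  -- double-sum pairing as a trace
  have pairing : ∀ X Y : Matrix (Fin 2) (Fin 2) ℂ, (∑ a, ∑ b, X a b * Y a b) = (X * Yᵀ).trace := by
    intro X Y
    simp only [Matrix.trace, Matrix.diag_apply, Matrix.mul_apply, Matrix.transpose_apply]
  have hUt : Uᴴᵀ = U.map conj := by
    ext i j; simp [Matrix.conjTranspose_apply, Matrix.map_apply]
  have hS : (∑ a, ∑ b, (∑ r, ∑ k, w' r (k, a) * conj (w' r (k, b))) * ∑ m, conj (φ' a m) * φ' b m)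
      = ∑ i, ∑ j, (∑ r, ∑ k, w r (k, i) * conj (w r (k, j))) * ∑ m, conj (φ i m) * φ j m := by
    have L : (∑ a, ∑ b, (∑ r, ∑ k, w' r (k, a) * conj (w' r (k, b))) * ∑ m, conj (φ' a m) * φ' b m)
        = ∑ a, ∑ b, (Uᵀ * P * U.map conj) a b * (Uᴴ * G * U) a b := by
      refine Finset.sum_congr rfl fun a _ => Finset.sum_congr rfl fun b _ => ?_
      rw [hπ' a b, e1 a b, ← e2 a b]
    have R : (∑ i, ∑ j, (∑ r, ∑ k, w r (k, i) * conj (w r (k, j))) * ∑ m, conj (φ i m) * φ j m)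
        = ∑ i, ∑ j, P i j * G i j := by
      refine Finset.sum_congr rfl fun i _ => Finset.sum_congr rfl fun j _ => ?_
      simp only [hP, hG, Matrix.of_apply]
    rw [L, R, pairing, pairing, Matrix.transpose_mul, Matrix.transpose_mul, hUt]
    -- trace (Uᵀ P Ū (Uᵀ (Gᵀ Ū)))... reorganise
    have : Uᵀ * P * U.map conj * (Uᵀ * (Gᵀ * U.map conj)) = Uᵀ * (P * Gᵀ) * U.map conj := by
      calc Uᵀ * P * U.map conj * (Uᵀ * (Gᵀ * U.map conj))
          = Uᵀ * P * (U.map conj * Uᵀ) * (Gᵀ * U.map conj) := by simp only [Matrix.mul_assoc]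
        _ = Uᵀ * (P * Gᵀ) * U.map conj := by rw [hUbar, Matrix.mul_one]; simp only [Matrix.mul_assoc]
    rw [this, Matrix.trace_mul_cycle, hUbar, Matrix.one_mul]
  have hN : (∑ a, ∑ m, ‖φ' a m‖ ^ 2) = ∑ i, ∑ m, ‖φ i m‖ ^ 2 := by
    have nre : ∀ (v : Fin 2 → κ → ℂ), (∑ a, ∑ m, ‖v a m‖ ^ 2 : ℝ) = (∑ a, ∑ m, conj (v a m) * v a m).re := by
      intro v; rw [Complex.re_sum]; refine Finset.sum_congr rfl fun a _ => ?_
      rw [Complex.re_sum]; exact Finset.sum_congr rfl fun m _ => by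
        rw [Complex.conj_mul', ← Complex.ofReal_pow, Complex.ofReal_re]
    rw [nre φ', nre φ]
    congr 1
    have L : (∑ a, ∑ m, conj (φ' a m) * φ' a m) = (Uᴴ * G * U).trace := by
      simp only [Matrix.trace, Matrix.diag_apply]
      exact Finset.sum_congr rfl fun a _ => by rw [e1 a a, ← e2 a a]
    have R : (∑ i, ∑ m, conj (φ i m) * φ i m) = G.trace := by
      simp only [Matrix.trace, Matrix.diag_apply, hG, Matrix.of_apply]
    rw [L, R, Matrix.trace_mul_cycle, hU2, Matrix.one_mul]
  have hslice' : (∑ a, ∑ b, (∑ r, ∑ k, w' r (k, a) * conj (w' r (k, b))) * ∑ m, conj (φ' a m) * φ' b m).re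
      = ∑ a, ∑ m, ‖φ' a m‖ ^ 2 := by rw [hS, hN]; exact hslice
  -- conclude
  have hmain := key_lemma_orth Q hQ w' hw'on φ' horth' hslice'
  rw [hN] at hmain
  simpa only [hF] using hmain

end Summit.MatrixMultiplication.MatrixMultiplication.Theorems.RankTwoAdditivity
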